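import Summits.QuantumFields.YangMills.Theorems.IR.Negative.OnsetMixingTypicalFalseOfMassWire
import Summits.QuantumFields.YangMills.Theorems.IR.Negative.TypShellCondUKPcFalseOfWildWire
import Summits.QuantumFields.YangMills.Theorems.BalabanLadderIRFrameCells
import Summits.QuantumFields.YangMills.Theses.BalabanLadder

/-!
# Format `Uc` of the line `af-pincer` for crux `IR` (item stmt-QuantumFields-19354, route-QuantumFields-BalabanLadder):
the generic pincer seams, the NAMED clauses with clause (i) AT EVERY CENTRE, and the triple `E^c / I^c / X^c` with its
kernel-checked composition to `IR`

Helper module for item `stmt-QuantumFields-19354` (`--supports`; it closes nothing).  This file is §A–§C of the REGISTERED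
slot of record `af-pincer-Uc` (route owner ym-beyond-p2 g28, ruling R65; bytes `pub/ym-beyond/p2-g28-files/line-af-pincer-Uc.reg.lean`,
sha16 `b6e69d9662b5b07a`; namespace `Summit.QuantumFields.YangMills.Cruxes.IR.AfPincerUc`) VERBATIM, made a tree constant so that
(owner ruling R72, «BYTES-FIRST») the slot can be re-based on `import …Theorems.IR.AfPincerUcFormat` + its §D (the three registered
stubs `stub_onsetUc : OnsetMixingTypicalUKPc`, `stub_typCriterionUc : TypCriterionUKPc`, `stub_afOnsetUc : AFToOnsetUKPc` and
`IR_of_stubsUc := ir_of_pincerUc …`), and every stub is then closed by a Theorems file proving a constant of THIS module BY NAME.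

Deltas against the slot bytes (filing seat ym-19354-afpincer-s1, 2026-08-27): (1) the import `…Cruxes.IR.Lines.birth` (a crux
workfile, not importable from `Theorems/`) is dropped; the one declaration of it that §C uses, `CellTempered.IRCal` (the verbatim body
of the route decl `BalabanLadder.IR`), is copied here as `AfPincerUc.IRCal`, and the `delta` in `ir_of_pincerUc` names that copy;
(2) `import …Theses.BalabanLadder` (reached through `birth` in the slot; it also supplies `DlrCollarTransfer.GapInUnits` /
`LowerBounds` / `Q2`) is made explicit; (3) this docstring; (4) §D (the three open stubs and `IR_of_stubsUc`) is NOT here; (5) (owner's first-touch sharpening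
S-Uc4, TEMPLATE-T1-Uc rev 3) `ClauseI` is the LANDED `Cruxes.IR.FixedMesh.ClauseI` (`Theorems/IR/Negative/FixedMesh/ClauseI.lean`,
string-equal to the slot's `ClauseI`), not re-declared; (6) (gate dedup) `shiftFrame_zero` is the landed
`Cruxes.IR.OnsetFormatsUc.shiftFrame_zero` (`Theorems/IR/Negative/TypShellCondUKPcFalseOfWildWire.lean`), not re-declared;
(7) two `Iff.rfl` bridges `typShellCondUKPc_iff_mirror` / `onsetMixingTypicalUKPc_iff_mirror` to the disprover's mirrors
`OnsetFormatsUc.TypShellCondUKPc` / `OnsetFormatsUc.OnsetMixingTypicalUKPc` (landed first, definitionally equal), so their typed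
negatives (`OnsetFormatsUc.not_onsetMixingTypicalUKPc_of_wildWireSU2`, …) transfer to the slot's constants by one rewrite.
Every other declaration, statement and proof is byte-identical to the slot.

## Contents
* §A generic pincer over a mixing format: `fmtSet`, `fmtOnset`, `fmtOnset_spec`, `fmtOnset_le`, `FmtClustering`,
  `fmtOnset_pinned` (LowerBounds(i) + «Q2 small below the onset» pin `a β · onset < T`), `gapInUnits_of_fmtOnset`, `fmtOnset_anti`.
* §B format Uc: `IsFrame`, `TypLocal`, `ClauseIAll` (clause (i) at EVERY centre for ONE
  family, via the tree's `CellTempered.Engine.shiftFrame`), `ClauseIIukp` (uniform-kernel Peierls rarity), `ClauseIII` (torus anchor),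
  `TypShellCondUKPc`, `typShellCondUKPc_iff_mirror`, `typShellCond_of_UKPc` (⇒ the tree mirror `OnsetFormats.TypShellCond`, so every typed
  negative against the registered T statement transfers).
* §C the triple `OnsetMixingTypicalUKPc` (I^c) / `TypCriterionUKPc` (E^c) / `AFToOnsetUKPc` (X^c), `mixOnsetUc`,
  `shellCount_lt_one_of_le`, `onsetMixingTypical_of_UKPc`, `onsetMixingTypicalUKPc_iff_mirror`, `fmtClustering_of_typCriterionUKPc`, `IRCal`, `irCal_of_pincerUc`,
  `ir_of_pincerUc : E^c → I^c → X^c → BalabanLadder.IR` (hypotheses form; real proof).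

HONEST FRAMING: vocabulary and bookkeeping for one open gap-crux of a CONDITIONAL chain (Track A 0/28 UV); the three Props are
hypotheses here, nothing is claimed about them; not a gap claim, not infinite volume, not Clay.
-/
set_option autoImplicit false

noncomputable section

open Filter Topology MeasureTheory
open scoped SchwartzMap
open Literature.MathematicalPhysics.QuantumFieldTheory Literature.MathematicalPhysics.QuantumLattice
open Summit.QuantumFields.YangMills.Cruxes.OSLegsFromFemtoAndGap.DlrCollarTransfer (GapInUnits LowerBounds Q2)
open Summit.QuantumFields.YangMills.Cruxes.IR.Tempered (cellEdges windowCells regionEdges)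
open Summit.QuantumFields.YangMills.Cruxes.IR.ShellTempered (windowCellsPlus)
open Summit.QuantumFields.YangMills.Cruxes.IR.CellTempered.Engine (shiftFrame cellEdges_shiftFrame)
open Summit.QuantumFields.YangMills.Cruxes.IR.FixedMesh (ClauseI)

namespace Summit.QuantumFields.YangMills.Cruxes.IR.AfPincerUc

/-! ## §A The generic pincer over a mixing format (verbatim copy of `AfPincerT` §A = `AfPincer` §5) -/
section Generic

variable {G : Type} [Group G] [TopologicalSpace G] [IsTopologicalGroup G] [CompactSpace G]
  [MeasurableSpace G] [BorelSpace G]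

/-- The meshes `b ≥ 1` at which a format `P` (coupling ↦ mesh ↦ Prop) holds at coupling `β`. -/
def fmtSet (P : ℝ → ℕ → Prop) (β : ℝ) : Set ℕ := {b : ℕ | 1 ≤ b ∧ P β b}

/-- **The onset of a format**: the least mesh at which it holds (`sInf`; `= 0` when it holds at no mesh). -/
def fmtOnset (P : ℝ → ℕ → Prop) (β : ℝ) : ℕ := sInf (fmtSet P β)

/-- The onset of a format that holds at some mesh is a mesh at which it holds. -/
theorem fmtOnset_spec (P : ℝ → ℕ → Prop) (β : ℝ) (h : (fmtSet P β).Nonempty) :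
    1 ≤ fmtOnset P β ∧ P β (fmtOnset P β) :=
  Nat.sInf_mem h

/-- The onset is at most any mesh at which the format holds. -/
theorem fmtOnset_le (P : ℝ → ℕ → Prop) (β : ℝ) {b : ℕ} (hb : 1 ≤ b) (hP : P β b) : fmtOnset P β ≤ b :=
  Nat.sInf_le ⟨hb, hP⟩

/-- **Clustering contract of a format at `(G, r)`** with rate `κ` and torus factor `s₀`: whenever the format holds at
mesh `b ≥ 1` and coupling `β`, every pair of species clusters at rate `κ / b` per lattice site on the tori of side
`2S+1 ≥ s₀ b`, with a constant `C(A, B)` uniform in `β`, `b`, `S`.  (The shape of v10's `OuterCriterion` conclusion.) -/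
def FmtClustering (r : LatticeRep G) (P : ℝ → ℕ → Prop) (κ : ℝ) (s₀ : ℕ) : Prop :=
  ∀ A B : YMSpecies G, ∃ C : ℝ, ∀ (β : ℝ) (b : ℕ), 1 ≤ b → P β b →
    ∀ S : ℕ, s₀ * b ≤ 2 * S + 1 → ∀ t : ℕ, t ≤ S →
      |latticeConnectedCorr r.ρ β (2 * S + 1) A.F B.F t| ≤ C * Real.exp (-(κ * t / b))

/-- **The generic pincer (PROVED; copy of `AfPincer.fmtOnset_pinned`).**  `LowerBounds`(i) and «`Q2`
small at every unit a factor `T` below the format onset» force `a β · fmtOnset P β < T` for all large `β`. -/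
theorem fmtOnset_pinned (P : ℝ → ℕ → Prop) (r : LatticeRep G) (a : ℝ → ℝ) (ha : ∀ β, 0 < a β)
    (hlb : LowerBounds G r a)
    (hX : ∀ v : 𝓢(EuclideanSpace ℝ (Fin 4), ℝ), tsupport v ⊆ {y : EuclideanSpace ℝ (Fin 4) | 0 < y 0} →
      ∀ η : ℝ, 0 < η → ∃ T β₁ : ℝ, ∀ β : ℝ, β₁ ≤ β → ∀ s : ℝ, 0 < s →
        T ≤ s * (fmtOnset P β : ℝ) →
          ∃ᶠ (L : ℕ) in atTop, |Q2 G r β L s (thetaTest 4 v) v| ≤ η) :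
    ∃ T β₆ : ℝ, ∀ β : ℝ, β₆ ≤ β → a β * (fmtOnset P β : ℝ) < T := by
  obtain ⟨⟨v, ε₅, β₅, Λ₅, hv, hε₅, hlow⟩, -⟩ := hlb
  obtain ⟨T, β₁, hT⟩ := hX v hv (ε₅ / 2) (half_pos hε₅)
  refine ⟨T, max β₁ β₅, fun β hβ => ?_⟩
  have hβ1 : β₁ ≤ β := le_trans (le_max_left _ _) hβ
  have hβ5 : β₅ ≤ β := le_trans (le_max_right _ _) hβ
  by_contra hge
  rw [not_lt] at hge
  have hfreq := hT β hβ1 (a β) (ha β) hge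
  have hev : ∀ᶠ (L : ℕ) in atTop, Λ₅ ≤ a β * (L : ℝ) :=
    (tendsto_natCast_atTop_atTop.const_mul_atTop (ha β)).eventually_ge_atTop Λ₅
  obtain ⟨L, hL1, hL2⟩ := (hfreq.and_eventually hev).exists
  have hlo := hlow β hβ5 L hL2
  have habs := le_abs_self (Q2 G r β L (a β) (thetaTest 4 v) v)
  linarith

/-- **The generic rate seam (PROVED; copy of `AfPincer.gapInUnits_of_fmtOnset`).**  A clustering
contract for `P` at rate `κ > 0`, the format holding at SOME mesh for all large `β`, and the pinning
`a β · fmtOnset P β < T` give `GapInUnits G r a` with `c₁ = κ / T`, `S₁ β = s₀ · fmtOnset P β`.  Pure arithmetic. -/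
theorem gapInUnits_of_fmtOnset {P : ℝ → ℕ → Prop} (r : LatticeRep G) (a : ℝ → ℝ) (ha : ∀ β, 0 < a β)
    {κ : ℝ} {s₀ : ℕ} (hκ : 0 < κ) (hcl : FmtClustering r P κ s₀)
    {β₂ : ℝ} (hon : ∀ β : ℝ, β₂ ≤ β → (fmtSet P β).Nonempty)
    {T β₆ : ℝ} (hpin : ∀ β : ℝ, β₆ ≤ β → a β * (fmtOnset P β : ℝ) < T) :
    GapInUnits G r a := by
  have hT : 0 < T := by
    have h1 := hpin (max β₂ β₆) (le_max_right _ _)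
    have h0 : 0 ≤ a (max β₂ β₆) * (fmtOnset P (max β₂ β₆) : ℝ) :=
      mul_nonneg (ha _).le (Nat.cast_nonneg _)
    linarith
  have hc₁ : 0 < κ / T := div_pos hκ hT
  refine ⟨κ / T, max β₂ β₆, fun β => s₀ * fmtOnset P β, hc₁, ?_⟩
  intro A B
  obtain ⟨C, hCb⟩ := hcl A B
  refine ⟨C, fun β hβ S t hS ht => ?_⟩
  have hβ2 : β₂ ≤ β := le_trans (le_max_left _ _) hβ
  have hβ6 : β₆ ≤ β := le_trans (le_max_right _ _) hβ
  obtain ⟨hb1, hP1⟩ := fmtOnset_spec P β (hon β hβ2)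
  have hbpos : (0 : ℝ) < (fmtOnset P β : ℝ) := by exact_mod_cast hb1
  have hS' : s₀ * fmtOnset P β ≤ S := hS
  have hside : s₀ * fmtOnset P β ≤ 2 * S + 1 := by omega
  have hbound := hCb β (fmtOnset P β) hb1 hP1 S hside t ht
  have hC0 : 0 ≤ C := by
    have h0 : 0 ≤ C * Real.exp (-(κ * (t : ℝ) / (fmtOnset P β : ℝ))) := (abs_nonneg _).trans hbound
    exact nonneg_of_mul_nonneg_left h0 (Real.exp_pos _)
  refine hbound.trans ?_
  gcongr
  have ht0 : (0 : ℝ) ≤ (t : ℝ) := by exact_mod_cast Nat.zero_le t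
  have hab : a β * (fmtOnset P β : ℝ) < T := hpin β hβ6
  rw [le_div_iff₀ hbpos]
  calc κ / T * a β * (t : ℝ) * (fmtOnset P β : ℝ)
      = κ / T * (t : ℝ) * (a β * (fmtOnset P β : ℝ)) := by ring
    _ ≤ κ / T * (t : ℝ) * T := by gcongr
    _ = κ * (t : ℝ) := by field_simp


/-- Onsets are ANTITONE in the format: if `P` implies `Q` mesh by mesh and `P` holds at some mesh, the `Q`-onset is at
most the `P`-onset.  (Used below: `b⋆_T ≤ b⋆_U`.) -/
theorem fmtOnset_anti (P Q : ℝ → ℕ → Prop) (β : ℝ) (h : ∀ b, P β b → Q β b) (hne : (fmtSet P β).Nonempty) :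
    fmtOnset Q β ≤ fmtOnset P β := by
  obtain ⟨hb, hP⟩ := fmtOnset_spec P β hne
  exact fmtOnset_le Q β hb (h _ hP)

end Generic

/-! ## §B Format Uc — NAMED clauses, clause (i) AT EVERY CENTRE for ONE family, (ii) in UKP form, (iii) verbatim
(`ym-cruxidea-19354-1` g6 `Sketch-g6-port.lean` §1 VERBATIM up to the namespace) -/

section Format

variable {G : Type} [Group G] [TopologicalSpace G] [IsTopologicalGroup G] [CompactSpace G]
  [MeasurableSpace G] [BorelSpace G]

/-- A mesh-`b` frame: `b ≤ w i (j+1) − w i j ≤ 2b` (the slot's binder, named). -/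
def IsFrame (b : ℕ) (w : Fin 4 → ℤ → ℤ) : Prop :=
  ∀ i j, w i j + ((b : ℕ) : ℤ) ≤ w i (j + 1) ∧ w i (j + 1) ≤ w i j + 2 * ((b : ℕ) : ℤ)

/-- The witness conjuncts of the slot: every `Typ c` is measurable and read off the cell's own edges. -/
def TypLocal (w : Fin 4 → ℤ → ℤ) (Typ : (Fin 4 → ℤ) → Set (LGConfig 4 G)) : Prop :=
  (∀ c, MeasurableSet (Typ c)) ∧ (∀ c, DependsOn (fun σ : LGConfig 4 G => σ ∈ Typ c) ↑(cellEdges w c))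

/-- **Clause (i) AT EVERY CENTRE** for one family: (i_T) (= the landed `FixedMesh.ClauseI`, string-equal to the slot's
`ClauseI`: sub-region mixing `≤ ε` at the CENTRE cell `0` for pairs typical off `Y` on window+shell and agreeing on the window
cells off `Y`) for the shifted frame `shiftFrame w c₀` (its cell `c` is the cell `c + c₀` of `w`, tree `cellEdges_shiftFrame`)
and the re-indexed family `c ↦ Typ (c + c₀)`, for all `c₀`. -/
def ClauseIAll {N : ℕ} (ρ : G →* Matrix (Fin N) (Fin N) ℂ) (β : ℝ) (w : Fin 4 → ℤ → ℤ) (n : ℕ) (ε : ℝ)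
    (Typ : (Fin 4 → ℤ) → Set (LGConfig 4 G)) : Prop :=
  ∀ c₀ : Fin 4 → ℤ, ClauseI ρ β (shiftFrame w c₀) n ε (fun c => Typ (c + c₀))

/-- Clause (ii) in UKP form (cplan `Sketch-g6-contagion` §U, VERBATIM): for `F ⊆ F'` and EVERY exterior `ζ` such
that each cell within sup-distance `1` of a charged cell is resampled or typical, `γ_{F'}(ζ){all F atypical} ≤ δ^#F`. -/
def ClauseIIukp {N : ℕ} (ρ : G →* Matrix (Fin N) (Fin N) ℂ) (β : ℝ) (w : Fin 4 → ℤ → ℤ) (δ : ℝ)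
    (Typ : (Fin 4 → ℤ) → Set (LGConfig 4 G)) : Prop :=
  ∀ F F' : Finset (Fin 4 → ℤ), F ⊆ F' → F.Nonempty → ∀ ζ : LGConfig 4 G,
    (∀ c ∈ F, ∀ c' : Fin 4 → ℤ, (∀ i, |c' i - c i| ≤ 1) → c' ∈ F' ∨ ζ ∈ Typ c') →
      (ymSpecification ρ β (regionEdges w F') ζ) {σ : LGConfig 4 G | ∀ c ∈ F, σ ∉ Typ c} ≤
        ENNReal.ofReal (δ ^ F.card)

/-- Clause (iii_T) of the slot VERBATIM (torus anchor; NOT consumed by the port of §3, kept for the slot's shape). -/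
def ClauseIII {N : ℕ} (ρ : G →* Matrix (Fin N) (Fin N) ℂ) (β : ℝ) (w : Fin 4 → ℤ → ℤ) (b : ℕ) (δ : ℝ)
    (Typ : (Fin 4 → ℤ) → Set (LGConfig 4 G)) : Prop :=
  ∀ S : ℕ, 4 * b ≤ 2 * S + 1 → ∀ F : Finset (Fin 4 → ℤ), F.Nonempty →
    (∀ c ∈ F, ∀ i, -(S : ℤ) ≤ w i (c i) ∧ w i (c i + 1) ≤ (S : ℤ) + 1) →
      (wilsonMeasure (d := 4) (L := 2 * S + 1) ρ β)
          {V : GaugeConfig 4 (2 * S + 1) G | ∀ c ∈ F, torusLift (2 * S + 1) V ∉ Typ c} ≤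
        ENNReal.ofReal (δ ^ F.card)

/-- **Format T, UKP currency, clause (i) at all centres** — the reshape this seat recommends alongside cplan's
§5(b): per frame ONE family `Typ` with locality, (i) at EVERY centre, (ii) in UKP form, (iii) verbatim. -/
def TypShellCondUKPc {N : ℕ} (ρ : G →* Matrix (Fin N) (Fin N) ℂ) (β : ℝ) (b n : ℕ) (ε δ : ℝ) : Prop :=
  ∀ w : Fin 4 → ℤ → ℤ, IsFrame b w →
    ∃ Typ : (Fin 4 → ℤ) → Set (LGConfig 4 G),
      TypLocal w Typ ∧ ClauseIAll ρ β w n ε Typ ∧ ClauseIIukp ρ β w δ Typ ∧ ClauseIII ρ β w b δ Typ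

/-- **`TypShellCondUKPc ⇒` the REGISTERED `TypShellCond`** (tree mirror `OnsetFormats.TypShellCond` = slot
:165–184 verbatim): (i) at centre `0` is the registered (i_T); UKP ⇒ (ii_T) exactly as cplan's
`typShellCond_of_typShellCondUKP`; (iii) identical.  So every typed kill of the registered I_T transfers. -/
theorem typShellCond_of_UKPc {N : ℕ} {ρ : G →* Matrix (Fin N) (Fin N) ℂ} {β : ℝ} {b n : ℕ} {ε δ : ℝ}
    (hU : TypShellCondUKPc ρ β b n ε δ) : OnsetFormats.TypShellCond ρ β b n ε δ := by
  intro w hw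
  obtain ⟨Typ, ⟨hm, hd⟩, hi, hii, hiii⟩ := hU w hw
  refine ⟨Typ, hm, hd, ?_, ?_, hiii⟩
  · have h := hi 0
    have hT : (fun c : Fin 4 → ℤ => Typ (c + 0)) = Typ := by funext c; rw [add_zero]
    rw [OnsetFormatsUc.shiftFrame_zero, hT] at h
    exact h
  · intro F F' hFF' hF ζ hcollar
    refine hii F F' hFF' hF ζ ?_
    intro c hc c' hc'
    by_cases h : c' ∈ F'
    · exact Or.inl h
    · exact Or.inr (hcollar c' h ⟨c, hFF' hc, hc'⟩)

/-- Bridge (filing delta (7)): the slot's `TypShellCondUKPc` IS the disprover's mirror `OnsetFormatsUc.TypShellCondUKPc`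
(`Theorems/IR/Negative/TypShellCondUKPcFalseOfWildWire.lean`), definitionally. -/
theorem typShellCondUKPc_iff_mirror {N : ℕ} (ρ : G →* Matrix (Fin N) (Fin N) ℂ) (β : ℝ) (b n : ℕ) (ε δ : ℝ) :
    TypShellCondUKPc ρ β b n ε δ ↔ OnsetFormatsUc.TypShellCondUKPc ρ β b n ε δ :=
  Iff.rfl

end Format

/-! ## §C The triple and its composition to `IRCal` / `IR` (`Sketch-g6-port.lean` §2 VERBATIM up to four renames) -/

section Triple

variable {G : Type} [Group G] [TopologicalSpace G] [IsTopologicalGroup G] [CompactSpace G]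
  [MeasurableSpace G] [BorelSpace G]

/-- The typical mixing onset in the reshaped currency. -/
def mixOnsetUc {N : ℕ} (ρ : G →* Matrix (Fin N) (Fin N) ℂ) (β : ℝ) (n : ℕ) (ε δ : ℝ) : ℕ :=
  fmtOnset (fun β' b => TypShellCondUKPc ρ β' b n ε δ) β

/-- **I^c — typical onset mixing, reshaped** (`OnsetMixingTypical` with `TypShellCond ↦ TypShellCondUKPc` and the
engine's admissibility constant `ε · shellCount n ≤ 3/4`). STRONGER than the registered I_T
(`onsetMixingTypical_of_UKPc`). -/
def OnsetMixingTypicalUKPc : Prop :=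
  ∀ (G : Type) [Group G] [TopologicalSpace G] [IsTopologicalGroup G] [CompactSpace G],
    IsCompactSimpleLieGroup G → letI : MeasurableSpace G := borel G; haveI : BorelSpace G := ⟨rfl⟩;
    ∀ r : LatticeRep G, ∃ (n : ℕ) (ε : ℝ), 1 ≤ n ∧ 0 ≤ ε ∧ ε * OnsetFormats.shellCount n ≤ 3 / 4 ∧
      ∀ δ : ℝ, 0 < δ → ∃ β₂ : ℝ, ∀ β : ℝ, β₂ ≤ β → ∃ b : ℕ, 1 ≤ b ∧ TypShellCondUKPc r.ρ β b n ε δ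

/-- **E^c — the typical-data criterion, reshaped** (`TypCriterion` with `TypShellCond ↦ TypShellCondUKPc`,
`ε · shellCount n ≤ 3/4`).  WEAKER hypothesis-side than the registered E_T (it assumes more of the data); this is
the statement §3 ports onto the tree engine. -/
def TypCriterionUKPc : Prop :=
  ∀ (n : ℕ) (ε : ℝ), 1 ≤ n → 0 ≤ ε → ε * OnsetFormats.shellCount n ≤ 3 / 4 →
    ∃ (δ₀ κ : ℝ) (s₀ : ℕ), 0 < δ₀ ∧ 0 < κ ∧ ∀ (G : Type) [Group G] [TopologicalSpace G] [IsTopologicalGroup G]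
      [CompactSpace G] [MeasurableSpace G] [BorelSpace G] (N : ℕ) (ρ : G →* Matrix (Fin N) (Fin N) ℂ),
      Continuous ρ → Function.Injective ρ → (∀ g, ρ g ∈ Matrix.unitaryGroup (Fin N) ℂ) →
        ∀ A B : LocalGaugeObservable 4 G, ∃ C : ℝ,
          ∀ (β : ℝ) (b : ℕ), 1 ≤ b → ∀ δ : ℝ, 0 < δ → δ ≤ δ₀ → TypShellCondUKPc ρ β b n ε δ →
            ∀ S : ℕ, s₀ * b ≤ 2 * S + 1 → ∀ t : ℕ, t ≤ S →
              |latticeConnectedCorr ρ β (2 * S + 1) A.F B.F t| ≤ C * Real.exp (-(κ * t / b))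

/-- **X^c — asymptotic freedom up to the reshaped typical onset** (`AFToOnsetT` with `mixOnsetT ↦ mixOnsetUc`,
`ε · shellCount n ≤ 3/4`).  Neither weaker nor stronger than the registered X_T (the onset moved). -/
def AFToOnsetUKPc : Prop :=
  ∀ (G : Type) [Group G] [TopologicalSpace G] [IsTopologicalGroup G] [CompactSpace G],
    IsCompactSimpleLieGroup G → letI : MeasurableSpace G := borel G; haveI : BorelSpace G := ⟨rfl⟩;
    ∀ (r : LatticeRep G) (n : ℕ) (ε : ℝ), 1 ≤ n → 0 ≤ ε → ε * OnsetFormats.shellCount n ≤ 3 / 4 → ∀ δ : ℝ, 0 < δ →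
      ∀ v : 𝓢(EuclideanSpace ℝ (Fin 4), ℝ), tsupport v ⊆ {y : EuclideanSpace ℝ (Fin 4) | 0 < y 0} →
        ∀ η : ℝ, 0 < η → ∃ T β₁ : ℝ, ∀ β : ℝ, β₁ ≤ β → ∀ s : ℝ, 0 < s →
          T ≤ s * (mixOnsetUc r.ρ β n ε δ : ℝ) →
            ∃ᶠ (L : ℕ) in atTop, |Q2 G r β L s (thetaTest 4 v) v| ≤ η

/-- `shellCount 1 = 1776 > 0`, so `ε · shellCount n ≤ 3/4 ⇒ ε · shellCount n < 1` … for `n ≥ 1` (arithmetic). -/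
theorem shellCount_lt_one_of_le {n : ℕ} {ε : ℝ} (h : ε * OnsetFormats.shellCount n ≤ 3 / 4) : ε * OnsetFormats.shellCount n < 1 := by
  linarith

/-- **I^c ⇒ I_T** (registered, tree mirror): the reshape is a strengthening of the supplier's stub, so nothing proved
against I_T (e.g. `OnsetFormats.not_onsetMixingTypical_of_massWireSU2`) is lost. -/
theorem onsetMixingTypical_of_UKPc (h : OnsetMixingTypicalUKPc) : OnsetFormats.OnsetMixingTypical := by
  intro G _ _ _ _ hG
  letI : MeasurableSpace G := borel G
  haveI : BorelSpace G := ⟨rfl⟩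
  intro r
  obtain ⟨n, ε, hn, hε, hM, hrest⟩ := h G hG r
  refine ⟨n, ε, hn, hε, shellCount_lt_one_of_le hM, fun δ hδ => ?_⟩
  obtain ⟨β₂, hβ⟩ := hrest δ hδ
  refine ⟨β₂, fun β hb => ?_⟩
  obtain ⟨b, hb1, hT⟩ := hβ β hb
  exact ⟨b, hb1, typShellCond_of_UKPc hT⟩

/-- Bridge (filing delta (7)): the slot's `OnsetMixingTypicalUKPc` (= stub `stub_onsetUc`) IS the disprover's mirror
`OnsetFormatsUc.OnsetMixingTypicalUKPc`, definitionally — so e.g. `OnsetFormatsUc.not_onsetMixingTypicalUKPc_of_wildWireSU2`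
is a typed negative against the registered stub by one rewrite. -/
theorem onsetMixingTypicalUKPc_iff_mirror : OnsetMixingTypicalUKPc ↔ OnsetFormatsUc.OnsetMixingTypicalUKPc :=
  Iff.rfl

/-- The reshaped bridge at `(G, r, n, ε, δ₀)` is a clustering contract for the reshaped format (bookkeeping). -/
theorem fmtClustering_of_typCriterionUKPc (hE : TypCriterionUKPc) (r : LatticeRep G) {n : ℕ} {ε : ℝ}
    (hn : 1 ≤ n) (hε : 0 ≤ ε) (hM : ε * OnsetFormats.shellCount n ≤ 3 / 4) :
    ∃ (δ₀ κ : ℝ) (s₀ : ℕ), 0 < δ₀ ∧ 0 < κ ∧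
      FmtClustering r (fun β b => TypShellCondUKPc r.ρ β b n ε δ₀) κ s₀ := by
  obtain ⟨δ₀, κ, s₀, hδ₀, hκ, hF⟩ := hE n ε hn hε hM
  refine ⟨δ₀, κ, s₀, hδ₀, hκ, fun A B => ?_⟩
  obtain ⟨C, hC⟩ := hF G r.N r.ρ r.continuous r.injective r.mem_unitary A B
  exact ⟨C, fun β b hb hP S hS t ht => hC β b hb δ₀ hδ₀ le_rfl hP S hS t ht⟩

/-- **IR (verbatim body of `Summit.QuantumFields.YangMills.Theses.BalabanLadder.IR`, item stmt-QuantumFields-19354)** — copy of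
`Cruxes.IR.CellTempered.IRCal` of the crux workfile `Cruxes/IR/Lines/birth.lean` (filing delta (1): that module is not importable
here).  For every compact simple `G`, every lattice representation `r` and every positive unit map `a → 0`: non-triviality in
units `a` (`LowerBounds`) implies a volume-uniform lattice mass gap in units `a` (`GapInUnits`). -/
def IRCal : Prop :=
  ∀ (G : Type) [Group G] [TopologicalSpace G] [IsTopologicalGroup G] [CompactSpace G],
    IsCompactSimpleLieGroup G → letI : MeasurableSpace G := borel G; haveI : BorelSpace G := ⟨rfl⟩;
    ∀ (r : LatticeRep G) (a : ℝ → ℝ), (∀ β, 0 < a β) → Tendsto a atTop (𝓝 0) →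
      LowerBounds G r a → GapInUnits G r a

/-- **Composition of the reshaped cut (real proof): `E^c → I^c → X^c → IRCal`** through the slot's generic seams at
`P β b := TypShellCondUKPc r.ρ β b n ε δ₀`. -/
theorem irCal_of_pincerUc (hE : TypCriterionUKPc) (hI : OnsetMixingTypicalUKPc) (hX : AFToOnsetUKPc) :
    IRCal := by
  intro G _ _ _ _ hG
  letI : MeasurableSpace G := borel G
  haveI : BorelSpace G := ⟨rfl⟩
  intro r a ha _ hlb
  obtain ⟨n, ε, hn, hε, hM, hIδ⟩ := hI G hG r
  obtain ⟨δ₀, κ, s₀, hδ₀, hκ, hcl⟩ := fmtClustering_of_typCriterionUKPc hE r hn hε hM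
  obtain ⟨β₂, hon⟩ := hIδ δ₀ hδ₀
  obtain ⟨T, β₆, hpin⟩ :=
    fmtOnset_pinned (fun β' b => TypShellCondUKPc r.ρ β' b n ε δ₀) r a ha hlb (hX G hG r n ε hn hε hM δ₀ hδ₀)
  exact gapInUnits_of_fmtOnset r a ha hκ hcl
    (fun β hβ => by obtain ⟨b, hb, hP⟩ := hon β hβ; exact ⟨b, hb, hP⟩) hpin

/-- The composition concludes the ROUTE DECL by name (as the slot's `IR_of_stubsT`, hypotheses form). -/
theorem ir_of_pincerUc (hE : TypCriterionUKPc) (hI : OnsetMixingTypicalUKPc) (hX : AFToOnsetUKPc) :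
    Summit.QuantumFields.YangMills.Theses.BalabanLadder.IR := by
  have h : IRCal := irCal_of_pincerUc hE hI hX
  delta Summit.QuantumFields.YangMills.Theses.BalabanLadder.IR
  delta Summit.QuantumFields.YangMills.Cruxes.IR.AfPincerUc.IRCal at h
  exact h

end Triple

end Summit.QuantumFields.YangMills.Cruxes.IR.AfPincerUc

end
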